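import Summits.ABC.ABC.Theorems.PadicPrimesYuNinetyTwoTransfer
import HarnessLib

/-!
# Route PadicPrimesW80TwoThirds, crux `W80Two` (`p = 2`, stmt-ABC-19486): the TRANSFER
# (2-adic Waldschmidt-shape engine on principal units `≡ 1 (mod 8)` ⇒ the crux text)

`Summits/ABC/StewartYu/YuNinetyW80TwoTransfer.lean` — cell `abc-stewartyu`
(HOME `run/shared/lean/pub/abc-stewartyu/`, seat lit; theorems only, no definition, no named fact;
the conclusion is the TEXT of `Summit.ABC.ABC.Theses.PadicPrimesW80TwoThirds.W80Two` verbatim, so the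
route's closer in `Summits/ABC/ABC/Theorems/` is `exact YuNinetyW80.two_of_w80Engine ⟨engine⟩`).
The `p = 2` sibling of p3's `Summit.ABC.StewartYu.YuNinetyW80.residueClass_of_w80Engine`
(`YuNinetyW80Transfer.lean`, odd residue classes, `c₅ = 41c₁`) and the W80-binder version of p1's
`padicPrimesYuNinety_two_of_engine` (`PadicPrimesYuNinetyTwoTransfer.lean`, Yu binder, `c₅ = 5c₁`).

ENGINE SHAPE at `p = 2` (the hypothesis `hE`, = what a `TwoSetup`-based Theorem A on the
`(log p)`-threaded record at `ℓ := 1`, `Mcl := 1` outputs — HOME/p1/W80Two-numerics-scoping.md §1):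
for rationals `αⱼ ≡ 1 (mod 8)` (`3 ≤ ord₂(αⱼ − 1)`), multiplicatively independent and CUBE-Kummer
(no `∏ αⱼ^{κⱼ}` with some `κⱼ ≢ 0 (mod 3)` is a rational cube — the hypothesis `hind` of lit's
`Multicub.ev3_ne_zero` / `MulticubLiouville.norm_ev3_ge_padic`), heights `h(αⱼ) ≤ Vⱼ`, floors
`1 ≤ Vⱼ ≤ Vmax`, `b ≠ 0`, `log max(3,|bⱼ|) ≤ W`, `1 ≤ W`:
`ord₂(∏ αⱼ^{bⱼ} − 1) ≤ C(m) · ∏ Vⱼ · (W + log 2Vmax) · log 2Vmax`, `C(m) ≤ c₁^m m^m`.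

TRANSFER (`two_of_w80Engine`): `αⱼ = qⱼ²` (`8 ∣ q² − 1`, p1's
`three_le_padicValRat_sq_sub_one`; squares of distinct primes are multiplicatively independent and
cube-Kummer, p1's `not_cube_prod_sq_primes`), `Vⱼ = 2 log max(4,qⱼ)`, `Vmax = 2X` (`X = log A`,
`A = max(4, max S)`), `W = log B` (`B ≥ 3 ⇒ W ≥ 1`); `ord₂(u − 1) ≤ ord₂(u² − 1)`; garbage
`log 2Vmax = log 4 + log X ≤ 7 log X` (`log X ≥ 0.27`), `W + log 2Vmax ≤ 7 (log B + log X)`,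
`49 · 2^m < 4 · 25^m` ⇒ the crux text `W80Two` with `c₅ = 25c₁`. Everything is [folklore]
book-keeping; WHAT THIS IS NOT: the engine is not proved here.
-/

noncomputable section

open Finset Real Height

namespace Summit.ABC.StewartYu

namespace YuNinetyW80

open Summit.ABC.ABC.Theorems

/-- `49 · 2^m < 4 · 25^m` for `m ≥ 1`. [folklore] -/
theorem fortynine_mul_two_pow_lt (m : ℕ) (hm : 1 ≤ m) : (49 : ℝ) * 2 ^ m < 4 * 25 ^ m := by
  obtain ⟨k, rfl⟩ : ∃ k, m = k + 1 := ⟨m - 1, by omega⟩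
  rw [pow_succ, pow_succ]
  have h : (2 : ℝ) ^ k ≤ 25 ^ k := pow_le_pow_left₀ (by norm_num) (by norm_num) k
  nlinarith [pow_pos (show (0 : ℝ) < 2 by norm_num) k]

/-- **Transfer at `p = 2`: Waldschmidt-shape `2`-adic engine ⇒ `W80Two`** (crux stmt-ABC-19486 of
route `PadicPrimesW80TwoThirds`), with the engine statement as the explicit hypothesis `hE`:
generators `αⱼ ≡ 1 (mod 8)`, multiplicatively independent, cube-Kummer, floors `1 ≤ Vⱼ ≤ Vmax`,
`1 ≤ W`, bound `C(m)·∏Vⱼ·(W + log 2Vmax)·log 2Vmax` with `C(m) ≤ c₁^m m^m` — gives the crux text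
with `c₅ = 25c₁` via `αⱼ = qⱼ²`. [folklore] -/
theorem two_of_w80Engine
    (hE : ∃ (C : ℕ → ℝ) (c₁ : ℝ), 1 ≤ c₁ ∧ (∀ m, 0 ≤ C m ∧ C m ≤ c₁ ^ m * (m : ℝ) ^ m) ∧
      ∀ (m : ℕ) (α : Fin m → ℚ) (b : Fin m → ℤ) (V : Fin m → ℝ) (Vmax W : ℝ),
        (∀ j, 3 ≤ padicValRat 2 (α j - 1)) →
        (∀ μ : Fin m → ℤ, ∏ j, α j ^ μ j = 1 → μ = 0) →
        (∀ κ : Fin m → ℕ, (∃ j, ¬ 3 ∣ κ j) → ∀ γ : ℚ, ∏ j, α j ^ κ j ≠ γ ^ 3) →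
        (∀ j, Height.logHeight₁ (α j) ≤ V j) → (∀ j, 1 ≤ V j) → (∀ j, V j ≤ Vmax) →
        b ≠ 0 → (∀ j, Real.log (max 3 (|b j| : ℝ)) ≤ W) → 1 ≤ W →
        (padicValRat 2 (∏ j, α j ^ b j - 1) : ℝ) ≤
          C m * (∏ j, V j) * (W + Real.log (2 * Vmax)) * Real.log (2 * Vmax)) :
    ∃ c₅ : ℝ, ∀ (S : Finset ℕ), (∀ q ∈ S, q.Prime) → 2 ∉ S → S.Nonempty → ∀ (e : ℕ → ℤ) (B : ℝ),
      3 ≤ B → (∀ q ∈ S, (|e q| : ℝ) ≤ B) → ∏ q ∈ S, (q : ℚ) ^ e q ≠ 1 →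
      (padicValRat 2 (∏ q ∈ S, (q : ℚ) ^ e q - 1) : ℝ) <
        (c₅ * S.card) ^ S.card * (2 : ℝ) ^ 2 *
          ((Real.log B + Real.log (Real.log ((max 4 (S.sup id) : ℕ) : ℝ))) *
            Real.log (Real.log ((max 4 (S.sup id) : ℕ) : ℝ))) *
          ∏ q ∈ S, Real.log ((max 4 q : ℕ) : ℝ) := by
  classical
  obtain ⟨C, c₁, hc₁, hC, hA⟩ := hE
  refine ⟨25 * c₁, ?_⟩
  intro S hS h2S hSne e B hB heB hne1
  -- enumeration of `S`
  set m : ℕ := S.card with hm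
  have hm1 : 1 ≤ m := Finset.card_pos.mpr hSne
  set φ : Fin m ≃ S := S.equivFin.symm with hφ
  set q : Fin m → ℕ := fun i => (φ i : ℕ) with hqdef
  have hqS : ∀ i, q i ∈ S := fun i => (φ i).2
  have hqP : ∀ i, (q i).Prime := fun i => hS _ (hqS i)
  have hinj : Function.Injective q := fun i j hij => φ.injective (Subtype.ext hij)
  have hq2 : ∀ i, q i ≠ 2 := fun i h => h2S (h ▸ hqS i)
  have hq0 : ∀ k, (q k : ℚ) ≠ 0 := fun k => by exact_mod_cast (hqP k).ne_zero
  have hreidx : ∀ {M : Type} [CommMonoid M] (f : ℕ → M), ∏ i, f (q i) = ∏ x ∈ S, f x := by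
    intro M _ f
    rw [← Finset.prod_coe_sort S f]
    exact Fintype.prod_equiv φ (fun i => f (q i)) (fun x => f x) (fun i => rfl)
  -- the data fed to the engine
  set M4 : ℝ := ((max 4 (S.sup id) : ℕ) : ℝ) with hM4
  set X : ℝ := Real.log M4 with hX
  set α : Fin m → ℚ := fun j => (q j : ℚ) ^ 2 with hα
  set b : Fin m → ℤ := fun j => e (q j) with hb
  set V : Fin m → ℝ := fun j => 2 * Real.log ((max 4 (q j) : ℕ) : ℝ) with hV
  set Vmax : ℝ := 2 * X with hVmax
  set W : ℝ := Real.log B with hW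
  have hX1 : (1.38 : ℝ) ≤ X := log_max_four_ge (S.sup id)
  have hℓ : (0.27 : ℝ) ≤ Real.log X := PadicPrimesYuNinetyRung.loglog_max_four_ge (S.sup id)
  have hX0 : 0 < X := by linarith
  have hlogmax : ∀ j, (1.38 : ℝ) ≤ Real.log ((max 4 (q j) : ℕ) : ℝ) := fun j =>
    log_max_four_ge (q j)
  -- `W ≥ 1` (`B ≥ 3 > e`)
  have hW1 : 1 ≤ W := by
    rw [hW, ← Real.log_exp 1]
    exact Real.log_le_log (Real.exp_pos 1) (le_trans (le_of_lt (Real.exp_one_lt_d9.trans (by norm_num))) hB)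
  -- the engine's hypotheses
  have h1 : ∀ j, 3 ≤ padicValRat 2 (α j - 1) := fun j =>
    three_le_padicValRat_sq_sub_one (hqP j) (hq2 j)
  have h2 : ∀ μ : Fin m → ℤ, ∏ j, α j ^ μ j = 1 → μ = 0 := by
    intro μ hμ
    have hμ' : ∏ j, (q j : ℚ) ^ ((2 : ℤ) * μ j) = 1 := by
      rw [← hμ]
      refine Finset.prod_congr rfl fun j _ => ?_
      simp only [hα]
      rw [zpow_mul]; norm_cast
    have h0 := Literature.Barriers.ABC.StewartTijdemanGeneric.prime_family_zpow_eq_one hqP hinj hμ'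
    funext j
    have := congrFun h0 j
    simp only [Pi.zero_apply, mul_eq_zero, OfNat.ofNat_ne_zero, false_or] at this
    exact this
  have h3 : ∀ κ : Fin m → ℕ, (∃ j, ¬ 3 ∣ κ j) → ∀ γ : ℚ, ∏ j, α j ^ κ j ≠ γ ^ 3 :=
    fun κ hκ γ => (not_cube_prod_sq_primes q hqP hinj κ hκ γ).symm
  have h4 : ∀ j, logHeight₁ (α j) ≤ V j := by
    intro j
    haveI : NeZero (q j ^ 2) := ⟨pow_ne_zero _ (hqP j).ne_zero⟩
    have hh : logHeight₁ (α j) = 2 * Real.log (q j) := by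
      have : α j = ((q j ^ 2 : ℕ) : ℚ) := by simp only [hα]; push_cast; ring
      rw [this, Rat.logHeight₁_natCast (q j ^ 2)]
      push_cast
      rw [Real.log_pow]; norm_num
    rw [hh]
    have hq4 : Real.log (q j) ≤ Real.log ((max 4 (q j) : ℕ) : ℝ) :=
      Real.log_le_log (by exact_mod_cast (hqP j).pos) (by exact_mod_cast le_max_right 4 (q j))
    show 2 * Real.log (q j) ≤ 2 * Real.log ((max 4 (q j) : ℕ) : ℝ)
    linarith
  have h5 : ∀ j, 1 ≤ V j := fun j => by
    show (1 : ℝ) ≤ 2 * Real.log ((max 4 (q j) : ℕ) : ℝ)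
    linarith [hlogmax j]
  have h6 : ∀ j, V j ≤ Vmax := by
    intro j
    have hle : ((max 4 (q j) : ℕ) : ℝ) ≤ M4 := by
      rw [hM4]
      exact_mod_cast max_le_max le_rfl (Finset.le_sup (f := id) (hqS j))
    have hpos : (0 : ℝ) < ((max 4 (q j) : ℕ) : ℝ) := by
      exact_mod_cast lt_of_lt_of_le (by norm_num) (le_max_left 4 (q j))
    show 2 * Real.log ((max 4 (q j) : ℕ) : ℝ) ≤ 2 * X
    linarith [Real.log_le_log hpos hle]
  -- `∏ αⱼ^{bⱼ} = u²`, `u = ∏_{q ∈ S} q^{e_q}`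
  set u : ℚ := ∏ x ∈ S, (x : ℚ) ^ e x with hu
  have hprodQ : ∏ j, (q j : ℚ) ^ b j = u := hreidx (fun x => (x : ℚ) ^ e x)
  have hprodα : ∏ j, α j ^ b j = u ^ 2 := by
    rw [← hprodQ, ← Finset.prod_pow]
    refine Finset.prod_congr rfl fun j _ => ?_
    simp only [hα]
    rw [← zpow_natCast, ← zpow_natCast, ← zpow_mul, ← zpow_mul, mul_comm]
  have h7 : b ≠ 0 := by
    intro h0
    apply hne1
    rw [← hprodQ]
    exact Finset.prod_eq_one fun j _ => by rw [show b j = 0 from congrFun h0 j, zpow_zero]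
  have hB0 : 0 < Real.log B := Real.log_pos (by linarith)
  have h8 : ∀ j, Real.log (max 3 (|b j| : ℝ)) ≤ W := by
    intro j
    have hle : max 3 (|b j| : ℝ) ≤ B := max_le hB (by simp only [hb]; exact heB _ (hqS j))
    exact Real.log_le_log (lt_of_lt_of_le (by norm_num) (le_max_left _ _)) hle
  -- the engine
  have key := hA m α b V Vmax W h1 h2 h3 h4 h5 h6 h7 h8 hW1
  rw [hprodα] at key
  -- `ord₂(u − 1) ≤ ord₂(u² − 1)`
  have hu1 : u - 1 ≠ 0 := sub_ne_zero.mpr hne1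
  have hupos : 0 < u := Finset.prod_pos fun x hx => zpow_pos (by exact_mod_cast (hS x hx).pos) _
  have hu1' : u + 1 ≠ 0 := by linarith
  have hvu : padicValRat 2 u = 0 := by
    rw [hu, Summit.ABC.StewartYu.PrincipalLattice.padicValRat_finset_prod _ _
      fun x hx => zpow_ne_zero _ (by exact_mod_cast (hS x hx).ne_zero)]
    refine Finset.sum_eq_zero fun x hx => ?_
    rw [padicValRat.zpow,
      Literature.Barriers.ABC.StewartTijdemanGeneric.padicValRat_natCast_prime_of_ne Nat.prime_two
        (hS x hx) (fun h => h2S (h ▸ hx))]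
    simp
  have hvplus : 0 ≤ padicValRat 2 (u + 1) := by
    have h := padicValRat.min_le_padicValRat_add (p := 2) hu1'
    rw [hvu, padicValRat.one, min_self] at h
    exact h
  have hvsq : padicValRat 2 (u ^ 2 - 1) = padicValRat 2 (u - 1) + padicValRat 2 (u + 1) := by
    rw [show u ^ 2 - 1 = (u - 1) * (u + 1) by ring, padicValRat.mul hu1 hu1']
  have hvle : (padicValRat 2 (u - 1) : ℝ) ≤ (padicValRat 2 (u ^ 2 - 1) : ℝ) := by
    rw [hvsq]; push_cast
    linarith [(show (0 : ℝ) ≤ (padicValRat 2 (u + 1) : ℝ) by exact_mod_cast hvplus)]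
  -- `∏ Vⱼ = 2^m · PL`
  set PL : ℝ := ∏ x ∈ S, Real.log ((max 4 x : ℕ) : ℝ) with hPL
  have hPV : ∏ j, V j = 2 ^ m * PL := by
    rw [hPL, ← hreidx (fun x => Real.log ((max 4 x : ℕ) : ℝ))]
    simp only [hV]
    rw [Finset.prod_mul_distrib, Finset.prod_const, Finset.card_univ, Fintype.card_fin]
  have hPL0 : 0 < PL := Finset.prod_pos fun x _ => by linarith [log_max_four_ge x]
  have hW0 : 0 < W := hB0
  have hlX0 : 0 < Real.log X := by linarith
  -- the garbage: `log 2Vmax = log 4 + log X ≤ 7 log X`, `W + log 2Vmax ≤ 7 (W + log X)`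
  have hlog4 : Real.log 4 < 1.3863 := by
    have h : Real.log 4 = 2 * Real.log 2 := by
      rw [show (4 : ℝ) = 2 ^ 2 by norm_num, Real.log_pow]; norm_num
    rw [h]; have := Real.log_two_lt_d9; linarith
  have hl2V : Real.log (2 * Vmax) = Real.log 4 + Real.log X := by
    rw [hVmax, show (2 : ℝ) * (2 * X) = 4 * X by ring, Real.log_mul (by norm_num) hX0.ne']
  have hg1 : Real.log (2 * Vmax) ≤ 7 * Real.log X := by rw [hl2V]; nlinarith
  have hg0 : 0 ≤ Real.log (2 * Vmax) := by
    rw [hl2V]; have h4pos : 0 < Real.log 4 := Real.log_pos (by norm_num); linarith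
  have hg2 : W + Real.log (2 * Vmax) ≤ 7 * (W + Real.log X) := by linarith
  have hgarb : (W + Real.log (2 * Vmax)) * Real.log (2 * Vmax) ≤
      49 * ((W + Real.log X) * Real.log X) := by
    calc (W + Real.log (2 * Vmax)) * Real.log (2 * Vmax)
        ≤ (7 * (W + Real.log X)) * (7 * Real.log X) :=
          mul_le_mul hg2 hg1 hg0 (by positivity)
      _ = 49 * ((W + Real.log X) * Real.log X) := by ring
  -- assemble
  set v : ℝ := (padicValRat 2 (u - 1) : ℝ) with hv
  have hCm := hC m
  have hG0 : 0 ≤ (W + Real.log X) * Real.log X := by positivity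
  have hstep1 : v ≤ C m * (2 ^ m * PL) * (49 * ((W + Real.log X) * Real.log X)) := by
    have h0 : 0 ≤ C m * (2 ^ m * PL) :=
      mul_nonneg hCm.1 (mul_nonneg (pow_nonneg (by norm_num) m) hPL0.le)
    calc v ≤ (padicValRat 2 (u ^ 2 - 1) : ℝ) := hvle
      _ ≤ C m * (∏ j, V j) * (W + Real.log (2 * Vmax)) * Real.log (2 * Vmax) := key
      _ = C m * (2 ^ m * PL) * ((W + Real.log (2 * Vmax)) * Real.log (2 * Vmax)) := by
          rw [hPV]; ring
      _ ≤ C m * (2 ^ m * PL) * (49 * ((W + Real.log X) * Real.log X)) :=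
          mul_le_mul_of_nonneg_left hgarb h0
  have hA0 : 0 < (W + Real.log X) * Real.log X * PL := mul_pos (mul_pos (by positivity) hlX0) hPL0
  have hcm0 : 0 < c₁ ^ m * (m : ℝ) ^ m := by
    have : (0 : ℝ) < m := by exact_mod_cast hm1
    positivity
  have h25 := fortynine_mul_two_pow_lt m hm1
  calc v ≤ C m * (2 ^ m * PL) * (49 * ((W + Real.log X) * Real.log X)) := hstep1
    _ ≤ (c₁ ^ m * (m : ℝ) ^ m) * (2 ^ m * PL) * (49 * ((W + Real.log X) * Real.log X)) := by
        have hr : 0 ≤ (2 ^ m * PL) * (49 * ((W + Real.log X) * Real.log X)) :=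
          mul_nonneg (mul_nonneg (pow_nonneg (by norm_num) m) hPL0.le) (by positivity)
        calc C m * (2 ^ m * PL) * (49 * ((W + Real.log X) * Real.log X))
            = C m * ((2 ^ m * PL) * (49 * ((W + Real.log X) * Real.log X))) := by ring
          _ ≤ (c₁ ^ m * (m : ℝ) ^ m) * ((2 ^ m * PL) * (49 * ((W + Real.log X) * Real.log X))) :=
              mul_le_mul_of_nonneg_right hCm.2 hr
          _ = _ := by ring
    _ = (49 * 2 ^ m) * ((c₁ ^ m * (m : ℝ) ^ m) * ((W + Real.log X) * Real.log X * PL)) := by ring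
    _ < (4 * 25 ^ m) * ((c₁ ^ m * (m : ℝ) ^ m) * ((W + Real.log X) * Real.log X * PL)) :=
        mul_lt_mul_of_pos_right h25 (mul_pos hcm0 hA0)
    _ = (25 * c₁ * m) ^ m * (2 : ℝ) ^ 2 * ((W + Real.log X) * Real.log X) * PL := by
        rw [mul_pow, mul_pow]; ring

end YuNinetyW80

end Summit.ABC.StewartYu

end
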